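import Summits.BirchSwinnertonDyer.BirchSwinnertonDyer.Theorems.ManinLocalTwoThreeCDivisionIntegralCDT
import Summits.BirchSwinnertonDyer.BirchSwinnertonDyer.Theorems.EdixhovenFibreFiveSevenStarredOptimalManinUnitFiveSevenCdtThm1
import HarnessLib

set_option autoImplicit false
-- the sub-problem namespace `Summit.BirchSwinnertonDyer.BirchSwinnertonDyer` duplicates a component by design (D-0017)
set_option linter.dupNamespace false

/-!
# Route ManinLocalTwoThree, residual C5 `ManinPrimeToAdditiveFiveLe` (stmt-BirchSwinnertonDyer-22969), closed by name

C5: granted the route's four printed-fact binders (all idle here), for every globally minimal `W/ℚ`, every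
lattice-optimal `X₀(N)`-datum `D` (`Λ_W = c · Λ_f`) and every prime `p ≥ 5` with `p² ∣ N`: `p ∤ c₀(D)`.

The landed conditional closer `ManinLocalTwoThree.CDivisionInt.maninPrimeToAdditiveFiveLe_of_CDTInt` (cell bsd-f2-manin,
p2: `|c₀| = 1` at a level with an odd square factor, from `Λ₁(f) ⊆ Λ_W` by the integer `c`-division chain) takes exactly
the printed Calegari–Dimitrov–Tang Theorem 1.0.1 as hypothesis; that hypothesis is now the tree theorem
`calegariDimitrovTang2025_unboundedDenominators_holds` (p826028, line `cdt_thm1` of crux K★ of route EdixhovenFibreFiveSeven,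
cell bsd-wall).  Composing the two proves the item BY NAME.  (This file necessarily imports the route-cone module carrying
the integer chain; the `lint.theses-cone` warning is accepted.)

HONEST STATUS.  Manin's conjecture is NOT announced by this file: the route's deciding theorem still takes
`PrintedSemistableManinFacts` (four cite-only printed facts) and C2 `ManinOddAtFour` (22967, claimed by seat manin23-p1).
BSD is not proved by this. [cite: CalegariDimitrovTang2025, Thm. 1.0.1] [cite: LingOesterle1991, Thm. 6]
-/

namespace Summit.BirchSwinnertonDyer.BirchSwinnertonDyer.Theorems

/-- **Residual C5 `ManinPrimeToAdditiveFiveLe` (stmt-BirchSwinnertonDyer-22969), proved by name**: `p ∤ c₀` for every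
prime `p ≥ 5` with `p² ∣ N` at every lattice-optimal `X₀(N)`-datum of a globally minimal curve — from CDT Theorem 1.0.1
(`calegariDimitrovTang2025_unboundedDenominators_holds`) through
`ManinLocalTwoThree.CDivisionInt.maninPrimeToAdditiveFiveLe_of_CDTInt`; the four printed-fact binders are idle.  Manin's
conjecture and BSD are NOT proved by this. [cite: CalegariDimitrovTang2025, Thm. 1.0.1] [cite: LingOesterle1991, Thm. 6] -/
theorem ManinLocalTwoThree.ManinPrimeToAdditiveFiveLe_proof :
    Summit.BirchSwinnertonDyer.BirchSwinnertonDyer.Theses.ManinLocalTwoThree.ManinPrimeToAdditiveFiveLe :=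
  ManinLocalTwoThree.CDivisionInt.maninPrimeToAdditiveFiveLe_of_CDTInt calegariDimitrovTang2025_unboundedDenominators_holds

end Summit.BirchSwinnertonDyer.BirchSwinnertonDyer.Theorems
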